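import Literature.MathematicalPhysics.QuantumFieldTheory.Balaban1983to89.B9Eq315QLipschitz
import Literature.MathematicalPhysics.QuantumFieldTheory.Balaban1983to89.B5Eq172FlatCoercivity

/-!
# `Balaban1983to89.B9Eq315QFlatRightInverse` — T. Bałaban, *Propagators for lattice gauge theories in a background field*, Commun. Math. Phys. **99**
# (1985) 389–434 [Balaban1985BackgroundPropagators] (3.15) p. 393 with Thm 3.11 p. 416 («(Q′G′²Q′*)⁻¹ … positive definite» — the averaging is onto),
# and *Averaging operations for lattice gauge theories*, Commun. Math. Phys. **98** (1985) 17–51 [Balaban1985Averaging] (125) p. 36: THE FLAT ONE-STEP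
# VECTOR AVERAGING `Q(1)` OF THE pub-balaban NE9 CHAIN HAS AN EXACT, EXPLICIT RIGHT INVERSE ON THE WEIGHTED `L²` CARRIERS WITH A VOLUME-FREE NORM
# BOUND `√(c₀·L^{d+2}∕c₁)`, HENCE `Q(1)†` HAS THE EXPLICIT INJECTIVITY MODULUS `(√(c₀·L^{d+2}∕c₁))⁻¹` — the «flat modulus μ_{Q1} of Q(1)†» that the
# NE9 owner's `B9Eq3126GreenLetters`∕`B9Eq3126H1Bound` (gen 80) obtain from `QtorusW_surjective` by compactness, made explicit

statement-level skeleton of published theorems with citation tags; proofs where landed; nothing here is a claim about the Yang–Mills mass gap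

PDF held: `paper:balaban1985-cmp99-background-propagators` (+388) pp. 393, 416; `paper:balaban1985-cmp98-averaging` p. 36 — read by this seat (2026-08-22).

THE PRINT (verbatim).  [B7] p. 36: *«The first term on the right-hand side above is the main term in this linear form, and it resembles the
definition of the averaging operation Q in [2]. … We will denote the main term by Q_{V₀} or Q₀ (Q₀A)_c = (Q_{V₀}A)_c = Σ_{x∈B(c₋)} L^{−(d+1)}
R_{0,c₋}A([x, x′]) (125)»* (the `L^{d+1}` straight-contour terms; tree: `B7Prop3Flat.Q0form`, `B9Eq315QLipschitz.linQcov_one_eq_smul_Q0form`).  [B9] p. 416, Thm 3.11: *«the operators Δ′_a, G′,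
(Q′G′²Q′*)⁻¹, Δ_a, G are positive definite»* — the inverse of `Q′G′²Q′*` exists because the averaging is ONTO (p. 395 «hence the existence of the
operator R»); the chain's `KinvLatticeK`/`H1LatticeK` (`B11Eq103H1Complex`) take `Function.Surjective Q` (`B9Eq315QTorusOnto.QtorusW_surjective`).

WHY THIS FILE (cell context).  The NE9 owner's gen-80 letters (H1) `B9Eq3126GreenLetters` (`norm_KinvK_le`: `‖K⁻¹‖ ≤ M²∕(γ μ_Q²)`, `norm_H1K_le`,
`norm_frakGLin_le`) display an injectivity modulus `μ_Q` of `Q†` (`μ_Q‖y‖ ≤ ‖Q†y‖`), and (H2) `B9Eq3126H1Bound` obtains the flat one `μ_{Q1}` for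
`Q(1)†` from `QtorusW_surjective` by compactness (`exists_modulus_of_injective`) — an unnamed, volume-dependent number.  The tree's quantitative right
inverse `B9Eq315QTorusOnto.exists_preimage_norm_le` (`‖A‖_∞ ≤ 2L^d‖v‖_∞`, Neumann series) is an `ℓ^∞` statement; read on the `L²` carriers it costs a
volume factor.  Here: an EXACT right inverse of the flat `Q(1)` on the `L²` carriers — put `L·y(c)` on the fine bonds parallel to `c` in the LAST
layer of the block `B(c₋)` (offset `L − 1` in the direction of `c`): every straight contour of (125) from `B(c₋)` meets that layer exactly once and no
other block's last layer — with the volume-free norm `√(c₀·L^{d+2}∕c₁)`, whence `μ_{Q1} = (√(c₀L^{d+2}∕c₁))⁻¹` (`= L⁻¹` at print's weights `c₁∕c₀ = L^d`).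

WHAT IS PROVED (sorry-free; no `Prop` placeholder; no inequality of the papers asserted as a hypothesis-free fact about their objects).
* §1 arithmetic of the contour sites `L·y + r + ie_κ` (`0 ≤ r_j, i < L`) on the torus: `lineSite_apply`, `perSite_val_eq_mod`, `blockCoord_lineSite`
  (block `y` when `r_κ + i ≤ L − 1`), `offset_lineSite` (`κ`-offset `(r_κ + i) mod L`), `offset_eq_iff` (`= L − 1 ⇔ i = L − 1 − r_κ`).
* §2 **`QtorusLin_one_lastLayer`**: for the `𝔸`-valued lift `g(z, κ) := [z_κ mod L = L−1]·L·v(blockCoord z, κ)`, `(Q(1)g)(c) = v(c)` EXACTLY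
  (flat form via `linQcov_one_eq_smul_Q0form` + `asum_seg_natCast`, one surviving term per `r`, `L^d` values of `r`); **`exists_rightInverse_QtorusW_one`**:
  `∃ Λ : BondL2K ℂ d m c₁ W →ₗ[ℂ] BondL2K ℂ d (L·m) c₀ W`, `Q(1) ∘ Λ = id` and `‖Λy‖ ≤ √(c₀·L^{d+2}∕c₁)·‖y‖` (`card_blockOf = L^d` per block, all `d`
  directions).
* §3 **`modulus_adjoint_QtorusW_one`**: `(√(c₀·L^{d+2}∕c₁))⁻¹·‖y‖ ≤ ‖(Q(1))† y‖` for every coarse `y` (`‖y‖² = re⟨Q(Λy), y⟩ = re⟨Λy, Q†y⟩`) — the `μ_Q`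
  slot of the owner's (H1) at the flat background, explicit and volume-free; `exists_modulus_adjoint_QtorusW_one` (∃-shape).
MODEL / DECLARED READINGS.  (M1) as `B9Eq315QTorus`/`B9Eq315QLipschitz`: torus `TSite d (L·m)`, `L ≥ 1`, fibre `W ≃ 𝔸` along `φ` (NO bound on `φ`
needed: it cancels), fine weight `c₀`, coarse weight `c₁`, the flat background's regularity letters `hα1′ hU1′ hreg′` arbitrary (the value of `QtorusW`
does not depend on them).  (M2) no hypothesis of the papers displayed.  (M3) NOT HERE: `Q(U)` for `U ≠ 1` (combine with the `δ_Q`-letter: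
`‖Q(U)†y‖ ≥ (μ_{Q1} − δ_Q)‖y‖`), print's multi-level `Q_j`; the constant is not optimal (the exact count of the last layer is `L^{d−1}` per block, giving
`√(c₀L^{d+1}∕c₁)`; the cruder `card_blockOf` bound is used).
HONEST SCOPE.  A [folklore] explicit right inverse for the chain's OWN flat averaging with bookkeeping; NOT summit progress (cell pub-balaban: NE9 NOT
PRINTED / NOT PROVED; spine PROVED 0/9; rung (B)+1 finite T⁴ — NOT infinite volume, NOT mass gap, NOT Clay).  Filed by the NE9 formalisation leaf
`b2b-balaban-t4-ne9-formalise-leaf-04` (gen 69); NEW file importing `B9Eq315QLipschitz`, `B5Eq172FlatCoercivity`; nothing modified.  Net new unproved facts: 0.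
-/

noncomputable section

open scoped BigOperators InnerProductSpace ComplexConjugate

namespace Literature.MathematicalPhysics.QuantumFieldTheory.Balaban1983to89.B9Eq315QFlatRightInverse

open B4Sect5Torus (TSite)
open B9SectCLatticeCarrier (Bond)
open B7Prop1Explicit (U1 Wcx boxVec seg asum e asum_seg_natCast)
open B7Prop3Flat (Q0form)
open B9Eq319QprimeTorus (fineP blockCoord)
open B9Eq311L2Pairing (WL2)
open B11Eq103H1Complex (BondL2K)
open B9Eq315QTorus (perSite perCfg cornerSite QtorusLin QtorusLin_apply QtorusW QtorusW_apply)
open B9Eq315QLipschitz (linQcov_one_eq_smul_Q0form perCfg_const_one)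
open B5Eq172FlatCoercivity (card_blockOf)

variable {d : ℕ} (L : ℕ) (m : Fin d → ℕ) [∀ i, NeZero (fineP L m i)]

/-! ## §1 The contour sites `L·y + r + ie_κ` read on the torus -/

section Arith

omit [∀ i, NeZero (fineP L m i)] in
/-- The coordinates of the contour site `L·y + r + ie_κ`. [cite: Balaban1985Averaging, (2) p.17, (125) p.36] -/
theorem lineSite_apply (y : TSite d m) (r : Fin d → Fin L) (κ : Fin d) (i : ℕ) (j : Fin d) :
    (cornerSite L y + boxVec L r + (i : ℤ) • e κ) j = ((L * (y j : ℕ) + ((r j : ℕ) + if j = κ then i else 0) : ℕ) : ℤ) := by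
  simp only [Pi.add_apply, Pi.smul_apply, cornerSite, boxVec, B7Prop1Explicit.e_apply, smul_eq_mul]
  split_ifs <;> push_cast <;> ring

/-- The torus coordinate of a site with a natural-number coordinate `n` is `n mod (L·m_j)`. [cite: Balaban1985Averaging, (1) p.17] -/
theorem perSite_val_eq_mod (x : B7Prop1Explicit.Site d) (j : Fin d) (n : ℕ) (hx : x j = n) :
    ((perSite (fineP L m) x j : ℕ)) = n % (L * m j) := by
  show ((x j) % ((fineP L m j : ℕ) : ℤ)).toNat = _
  rw [hx, show ((fineP L m j : ℕ) : ℤ) = ((L * m j : ℕ) : ℤ) from rfl, ← Int.natCast_mod, Int.toNat_natCast]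

/-- `(L·k + t) mod (L·m_j)`, `k < m_j`, `t < L`: the block coordinate is `k` and the offset is `t`. [cite: Balaban1985Averaging, (2) p.17] -/
theorem div_mod_of_lt (j : Fin d) {k t : ℕ} (hk : k < m j) (ht : t < L) :
    (L * k + t) % (L * m j) / L = k ∧ (L * k + t) % (L * m j) % L = t := by
  have hL : 0 < L := Nat.pos_of_ne_zero fun h => NeZero.ne (fineP L m j) (by rw [show fineP L m j = L * m j from rfl, h, zero_mul])
  have hlt : L * k + t < L * m j :=
    calc L * k + t < L * k + L := by omega
      _ = L * (k + 1) := by ring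
      _ ≤ L * m j := Nat.mul_le_mul_left L hk
  rw [Nat.mod_eq_of_lt hlt, Nat.mul_add_div hL, Nat.div_eq_of_lt ht, add_zero, Nat.mul_add_mod, Nat.mod_eq_of_lt ht]
  exact ⟨rfl, rfl⟩

/-- **The contour site `L·y + r + ie_κ` with `r_κ + i ≤ L − 1` lies in the block `B(y)`.** [cite: Balaban1985Averaging, (2) p.17, (125) p.36] -/
theorem blockCoord_lineSite (y : TSite d m) (r : Fin d → Fin L) (κ : Fin d) {i : ℕ} (hri : (r κ : ℕ) + i ≤ L - 1) :
    blockCoord L m (perSite (fineP L m) (cornerSite L y + boxVec L r + (i : ℤ) • e κ)) = y := by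
  funext j
  apply Fin.ext
  rw [B9Eq319QprimeTorus.blockCoord_apply_val, perSite_val_eq_mod L m _ j _ (lineSite_apply L m y r κ i j)]
  have ht : (r j : ℕ) + (if j = κ then i else 0) < L := by
    have := (r j).isLt
    split_ifs with h
    · subst h; omega
    · omega
  exact (div_mod_of_lt L m j (y j).isLt ht).1

/-- **The `κ`-offset of the contour site is `(r_κ + i) mod L`.** [cite: Balaban1985Averaging, (2) p.17, (125) p.36] -/
theorem offset_lineSite (y : TSite d m) (r : Fin d → Fin L) (κ : Fin d) (i : ℕ) :
    ((perSite (fineP L m) (cornerSite L y + boxVec L r + (i : ℤ) • e κ) κ : ℕ)) % L = ((r κ : ℕ) + i) % L := by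
  rw [perSite_val_eq_mod L m _ κ _ (lineSite_apply L m y r κ i κ), if_pos rfl, Nat.mod_mul_right_mod, add_comm (L * _), Nat.add_mul_mod_self_left]

omit [∀ i, NeZero (fineP L m i)] in
/-- For `s, i < L`: `(s + i) mod L = L − 1 ⇔ i = L − 1 − s`. [folklore] [cite: Balaban1985Averaging, (125) p.36] -/
theorem offset_eq_iff {s i : ℕ} (hs : s < L) (hi : i < L) : (s + i) % L = L - 1 ↔ i = L - 1 - s := by
  constructor
  · intro h
    by_cases hlt : s + i < L
    · rw [Nat.mod_eq_of_lt hlt] at h; omega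
    · rw [Nat.mod_eq_sub_mod (by omega), Nat.mod_eq_of_lt (by omega)] at h
      omega
  · intro h
    rw [h, show s + (L - 1 - s) = L - 1 by omega, Nat.mod_eq_of_lt (by omega)]

end Arith

/-! ## §2 The last-layer lift is an exact right inverse of the flat `Q(1)` -/

section Lift

variable {𝔸 : Type*} [NormedRing 𝔸] [NormOneClass 𝔸] [NormedAlgebra ℂ 𝔸] [CompleteSpace 𝔸] (hL : 1 ≤ L)
  {α' : ℝ} (hα1' : α' ≤ 1 / 64)
  (hU1' : ∀ (x : B7Prop1Explicit.Site d) (κ : Fin d), perCfg (fineP L m) (fun _ : Bond d (fineP L m) => (1 : 𝔸ˣ)) x κ ∈ U1 𝔸)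
  (hreg' : ∀ (y : TSite d m) (κ : Fin d) (r : Fin d → Fin L),
    ‖((Wcx L (perCfg (fineP L m) (fun _ : Bond d (fineP L m) => (1 : 𝔸ˣ))) (cornerSite L y) κ (boxVec L r) : 𝔸ˣ) : 𝔸) - 1‖ ≤ α')

/-- **THE LAST-LAYER LIFT IS INVERTED BY `Q(1)` EXACTLY**: for a coarse `𝔸`-valued bond function `v` and the fine function
`g(z, κ) := if z_κ mod L = L − 1 then L·v(blockCoord z, κ) else 0`, `(Q(1)g)(c) = v(c)` for every coarse bond `c` — in the flat form (125)
(`L^{−(d+1)}·Σ_r Σ_{i<L} g(L·y + r + ie_κ, κ)`, `linQcov_one_eq_smul_Q0form` + `asum_seg_natCast`) exactly one `i` per `r` meets the last layer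
(`i = L − 1 − r_κ`, then the site lies in `B(y)`), and there are `L^d` values of `r`. [cite: Balaban1985Averaging, (125) p.36; Balaban1985BackgroundPropagators, (3.15) p.393] -/
theorem QtorusLin_one_lastLayer (v : Bond d m → 𝔸) (c : Bond d m) :
    QtorusLin L m hL (fun _ => 1) hα1' hU1' hreg'
        (fun b : Bond d (fineP L m) => if ((b.1 b.2 : ℕ)) % L = L - 1 then ((L : ℂ) • v (blockCoord L m b.1, b.2)) else 0) c = v c := by
  classical
  haveI : NeZero L := ⟨by omega⟩
  set g : Bond d (fineP L m) → 𝔸 := fun b => if ((b.1 b.2 : ℕ)) % L = L - 1 then ((L : ℂ) • v (blockCoord L m b.1, b.2)) else 0 with hg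
  have hL0 : (L : ℂ) ≠ 0 := by exact_mod_cast (by omega : L ≠ 0)
  -- the flat form (125) of `Q(1)` on the torus
  have hflat : QtorusLin L m hL (fun _ => 1) hα1' hU1' hreg' g c =
      (((L : ℝ) ^ (d + 1))⁻¹ : ℝ) • ∑ r : Fin d → Fin L, ∑ i ∈ Finset.range L,
        g (perSite (fineP L m) (cornerSite L c.1 + boxVec L r + (i : ℤ) • e c.2), c.2) := by
    have hA : ∀ (x : B7Prop1Explicit.Site d) (κ : Fin d), ‖perCfg (fineP L m) g x κ‖ ≤ ‖g‖ := fun x κ => norm_le_pi_norm g _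
    rw [QtorusLin_apply, perCfg_const_one, linQcov_one_eq_smul_Q0form L (norm_nonneg g) hA hL (cornerSite L c.1) c.2,
      RCLike.real_smul_eq_coe_smul (K := ℂ), smul_smul, RCLike.ofReal_natCast, inv_mul_cancel₀ hL0, one_smul]
    unfold Q0form
    rw [Finset.smul_sum]
    refine Finset.sum_congr rfl fun r _ => ?_
    rw [asum_seg_natCast]
    rfl
  -- one surviving term per `r`
  have hinner : ∀ r : Fin d → Fin L, ∑ i ∈ Finset.range L, g (perSite (fineP L m) (cornerSite L c.1 + boxVec L r + (i : ℤ) • e c.2), c.2)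
      = (L : ℂ) • v c := by
    intro r
    have hrκ : (r c.2 : ℕ) < L := (r c.2).isLt
    rw [Finset.sum_eq_single (L - 1 - (r c.2 : ℕ))]
    · have hi : (r c.2 : ℕ) + (L - 1 - (r c.2 : ℕ)) ≤ L - 1 := by omega
      rw [hg]; dsimp only
      rw [offset_lineSite, if_pos ((offset_eq_iff L hrκ (by omega)).2 rfl), blockCoord_lineSite L m c.1 r c.2 hi]
    · intro i hi hne
      rw [hg]; dsimp only
      rw [offset_lineSite, if_neg (fun h => hne ((offset_eq_iff L hrκ (Finset.mem_range.1 hi)).1 h))]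
    · intro h; exact absurd (Finset.mem_range.2 (by omega)) h
  rw [hflat]
  simp_rw [hinner]
  rw [Finset.sum_const, Finset.card_univ, Fintype.card_fun, Fintype.card_fin, Fintype.card_fin, ← Nat.cast_smul_eq_nsmul ℂ, smul_smul,
    RCLike.real_smul_eq_coe_smul (K := ℂ), smul_smul, RCLike.ofReal_inv, RCLike.ofReal_pow, RCLike.ofReal_natCast]
  have : ((L : ℂ) ^ (d + 1))⁻¹ * (((L ^ d : ℕ) : ℂ) * (L : ℂ)) = 1 := by
    push_cast
    rw [← pow_succ, inv_mul_cancel₀ (pow_ne_zero _ hL0)]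
  rw [this, one_smul]

variable [NeZero L] {W : Type*} [NormedAddCommGroup W] [InnerProductSpace ℂ W] (φ : W ≃ₗ[ℂ] 𝔸) {c₀ c₁ : ℝ} [Fact (0 < c₀)] [Fact (0 < c₁)]

/-- **THE FLAT `Q(1)` HAS AN EXACT RIGHT INVERSE ON THE CHAIN'S `L²` CARRIERS WITH A VOLUME-FREE NORM BOUND**: there is a `ℂ`-linear
`Λ : BondL2K ℂ d m c₁ W → BondL2K ℂ d (L·m) c₀ W` with `Q(1)(Λy) = y` for all `y` and `‖Λy‖ ≤ √(c₀·L^{d+2}∕c₁)·‖y‖` — the last-layer lift of §2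
read through `φ` (which cancels) and the weighted norms (`card_blockOf = L^d` per block). [cite: Balaban1985BackgroundPropagators, (3.15) p.393, Thm 3.11 p.416; Balaban1985Averaging, (125) p.36] -/
theorem exists_rightInverse_QtorusW_one :
    ∃ Λ : BondL2K ℂ d m c₁ W →ₗ[ℂ] BondL2K ℂ d (fineP L m) c₀ W,
      (∀ y, QtorusW L m hL φ (fun _ => 1) hα1' hU1' hreg' (c₁ := c₁) (Λ y) = y) ∧
      ∀ y, ‖Λ y‖ ≤ Real.sqrt (c₀ * (L : ℝ) ^ (d + 2) / c₁) * ‖y‖ := by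
  classical
  have hc₀ : 0 < c₀ := Fact.out
  have hc₁ : 0 < c₁ := Fact.out
  -- the lift on plain functions
  let Lpi : (Bond d m → W) →ₗ[ℂ] (Bond d (fineP L m) → W) :=
    { toFun := fun Y b => if ((b.1 b.2 : ℕ)) % L = L - 1 then ((L : ℂ) • Y (blockCoord L m b.1, b.2)) else 0
      map_add' := fun Y Y' => by
        funext b; simp only [Pi.add_apply]; split_ifs <;> simp [smul_add]
      map_smul' := fun a Y => by
        funext b; simp only [Pi.smul_apply, RingHom.id_apply]; split_ifs <;> simp [smul_comm a] }
  have hLpi : ∀ Y b, Lpi Y b = if ((b.1 b.2 : ℕ)) % L = L - 1 then ((L : ℂ) • Y (blockCoord L m b.1, b.2)) else 0 := fun _ _ => rfl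
  let Λ : BondL2K ℂ d m c₁ W →ₗ[ℂ] BondL2K ℂ d (fineP L m) c₀ W :=
    (WL2.linearEquiv ℂ ℂ (fun _ : Bond d (fineP L m) => c₀)).symm.toLinearMap ∘ₗ Lpi ∘ₗ
      (WL2.linearEquiv ℂ ℂ (fun _ : Bond d m => c₁)).toLinearMap
  have hΛ : ∀ y b, WL2.equiv ℂ _ W (Λ y) b = Lpi (WL2.equiv ℂ _ W y) b := fun _ _ => rfl
  refine ⟨Λ, fun y => ?_, fun y => ?_⟩
  · -- right inverse: through `φ`, §2 at `v := φ ∘ y`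
    apply (WL2.equiv ℂ (fun _ : Bond d m => c₁) W).injective
    funext c
    rw [QtorusW_apply]
    have hg : (fun b => φ (WL2.equiv ℂ _ W (Λ y) b)) =
        fun b : Bond d (fineP L m) => if ((b.1 b.2 : ℕ)) % L = L - 1 then
          ((L : ℂ) • φ (WL2.equiv ℂ _ W y (blockCoord L m b.1, b.2))) else 0 := by
      funext b
      rw [hΛ, hLpi]
      split_ifs
      · rw [map_smul]
      · rw [map_zero]
    have h3 := QtorusLin_one_lastLayer L m hL hα1' hU1' hreg' (fun c' => φ (WL2.equiv ℂ _ W y c')) c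
    rw [hg, h3, LinearEquiv.symm_apply_apply]
  · -- norm bound
    have hsq : ‖Λ y‖ ^ 2 ≤ (Real.sqrt (c₀ * (L : ℝ) ^ (d + 2) / c₁) * ‖y‖) ^ 2 := by
      rw [WL2.norm_sq (Λ y), mul_pow, Real.sq_sqrt (by positivity), WL2.norm_sq y]
      -- pointwise: `c₀‖(Λy)(z,κ)‖² ≤ c₀ L² ‖y(blockCoord z, κ)‖²`
      have hpt : ∀ b : Bond d (fineP L m), c₀ * ‖WL2.equiv ℂ _ W (Λ y) b‖ ^ 2 ≤
          c₀ * ((L : ℝ) ^ 2 * ‖WL2.equiv ℂ _ W y (blockCoord L m b.1, b.2)‖ ^ 2) := fun b => by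
        refine mul_le_mul_of_nonneg_left ?_ hc₀.le
        rw [hΛ, hLpi]
        split_ifs
        · rw [norm_smul, Complex.norm_natCast, mul_pow]
        · rw [norm_zero, zero_pow two_ne_zero]; positivity
      refine (Finset.sum_le_sum fun b _ => hpt b).trans (le_of_eq ?_)
      -- count: each coarse bond `(w, κ)` is hit by the `L^d` fine sites of `B(w)`
      rw [Fintype.sum_prod_type, Fintype.sum_prod_type, Finset.mul_sum]
      simp_rw [Finset.mul_sum]
      rw [Finset.sum_comm]
      conv_rhs => rw [Finset.sum_comm]
      refine Finset.sum_congr rfl fun κ _ => ?_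
      rw [← Finset.sum_fiberwise_of_maps_to (s := Finset.univ) (t := Finset.univ) (g := blockCoord L m) (fun z _ => Finset.mem_univ _)]
      refine Finset.sum_congr rfl fun w _ => ?_
      rw [Finset.sum_congr rfl fun z (hz : z ∈ Finset.univ.filter fun z => blockCoord L m z = w) => by
        rw [(Finset.mem_filter.1 hz).2], Finset.sum_const,
        show (Finset.univ.filter fun z : TSite d (fineP L m) => blockCoord L m z = w) = B9Eq319QprimeTorus.blockOf L m w from rfl,
        card_blockOf, nsmul_eq_mul]
      push_cast
      field_simp
      ring
    have h0 : 0 ≤ Real.sqrt (c₀ * (L : ℝ) ^ (d + 2) / c₁) * ‖y‖ := by positivity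
    exact (pow_le_pow_iff_left₀ (norm_nonneg _) h0 two_ne_zero).1 hsq

end Lift

/-! ## §3 The explicit injectivity modulus of `Q(1)†` -/

section Adjoint

variable {𝔸 : Type*} [NormedRing 𝔸] [NormOneClass 𝔸] [NormedAlgebra ℂ 𝔸] [CompleteSpace 𝔸] [NeZero L] (hL : 1 ≤ L)
  {α' : ℝ} (hα1' : α' ≤ 1 / 64)
  (hU1' : ∀ (x : B7Prop1Explicit.Site d) (κ : Fin d), perCfg (fineP L m) (fun _ : Bond d (fineP L m) => (1 : 𝔸ˣ)) x κ ∈ U1 𝔸)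
  (hreg' : ∀ (y : TSite d m) (κ : Fin d) (r : Fin d → Fin L),
    ‖((Wcx L (perCfg (fineP L m) (fun _ : Bond d (fineP L m) => (1 : 𝔸ˣ))) (cornerSite L y) κ (boxVec L r) : 𝔸ˣ) : 𝔸) - 1‖ ≤ α')
  {W : Type*} [NormedAddCommGroup W] [InnerProductSpace ℂ W] [FiniteDimensional ℂ W] (φ : W ≃ₗ[ℂ] 𝔸) {c₀ c₁ : ℝ}
  [Fact (0 < c₀)] [Fact (0 < c₁)]

/-- **THE EXPLICIT INJECTIVITY MODULUS OF `Q(1)†`**: `(√(c₀·L^{d+2}∕c₁))⁻¹·‖y‖ ≤ ‖Q(1)†y‖` for every coarse `y` — from the right inverse `Λ` of §2: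
`‖y‖² = re⟨Q(1)(Λy), y⟩ = re⟨Λy, Q(1)†y⟩ ≤ ‖Λy‖·‖Q(1)†y‖`.  The `μ_Q`-slot of the owner's Green letters at the flat background, volume-free
(`= L⁻¹` at print's weights `c₁ = L^d c₀`). [cite: Balaban1985BackgroundPropagators, (3.15) p.393, Thm 3.11 p.416; Balaban1985Averaging, (125) p.36] -/
theorem modulus_adjoint_QtorusW_one (y : BondL2K ℂ d m c₁ W) :
    (Real.sqrt (c₀ * (L : ℝ) ^ (d + 2) / c₁))⁻¹ * ‖y‖ ≤
      ‖LinearMap.adjoint (QtorusW L m hL φ (fun _ => 1) hα1' hU1' hreg' (c₀ := c₀) (c₁ := c₁)) y‖ := by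
  have hc₀ : 0 < c₀ := Fact.out
  have hc₁ : 0 < c₁ := Fact.out
  have hL0 : (0 : ℝ) < L := by exact_mod_cast (by omega : 0 < L)
  set s : ℝ := Real.sqrt (c₀ * (L : ℝ) ^ (d + 2) / c₁) with hs
  have hs0 : 0 < s := Real.sqrt_pos.2 (by positivity)
  obtain ⟨Λ, hQΛ, hΛ⟩ := exists_rightInverse_QtorusW_one L m hL hα1' hU1' hreg' φ (c₀ := c₀) (c₁ := c₁)
  set Q := QtorusW L m hL φ (fun _ => 1) hα1' hU1' hreg' (c₀ := c₀) (c₁ := c₁) with hQ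
  -- `‖y‖² ≤ ‖Λy‖·‖Q†y‖ ≤ s‖y‖·‖Q†y‖`
  have h1 : ‖y‖ ^ 2 ≤ s * ‖y‖ * ‖LinearMap.adjoint Q y‖ := by
    have h := LinearMap.adjoint_inner_right Q (Λ y) y
    rw [hQΛ y] at h
    calc ‖y‖ ^ 2 = (⟪y, y⟫_ℂ).re := by rw [← inner_self_eq_norm_sq (𝕜 := ℂ) y]; rfl
      _ = (⟪Λ y, LinearMap.adjoint Q y⟫_ℂ).re := by rw [h]
      _ ≤ ‖Λ y‖ * ‖LinearMap.adjoint Q y‖ := (Complex.re_le_norm _).trans (norm_inner_le_norm _ _)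
      _ ≤ s * ‖y‖ * ‖LinearMap.adjoint Q y‖ := mul_le_mul_of_nonneg_right (hΛ y) (norm_nonneg _)
  by_cases hy : y = 0
  · rw [hy, norm_zero, mul_zero]; exact norm_nonneg _
  · have hypos : 0 < ‖y‖ := norm_pos_iff.2 hy
    have h2 : ‖y‖ ≤ s * ‖LinearMap.adjoint Q y‖ :=
      le_of_mul_le_mul_right (by rw [← sq]; linarith [h1]) hypos
    rw [inv_mul_le_iff₀ hs0]
    exact h2

/-- **The ∃-shape** (for destructuring consumers): `∃ μ > 0, ∀ y, μ‖y‖ ≤ ‖Q(1)†y‖` with `μ := (√(c₀·L^{d+2}∕c₁))⁻¹`.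
[cite: Balaban1985BackgroundPropagators, (3.15) p.393, Thm 3.11 p.416] -/
theorem exists_modulus_adjoint_QtorusW_one :
    ∃ μ : ℝ, 0 < μ ∧ ∀ y : BondL2K ℂ d m c₁ W,
      μ * ‖y‖ ≤ ‖LinearMap.adjoint (QtorusW L m hL φ (fun _ => 1) hα1' hU1' hreg' (c₀ := c₀) (c₁ := c₁)) y‖ := by
  have hc₀ : 0 < c₀ := Fact.out
  have hc₁ : 0 < c₁ := Fact.out
  have hL0 : (0 : ℝ) < L := by exact_mod_cast (by omega : 0 < L)
  exact ⟨_, inv_pos.2 (Real.sqrt_pos.2 (by positivity)), modulus_adjoint_QtorusW_one L m hL hα1' hU1' hreg' φ⟩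

end Adjoint

end Literature.MathematicalPhysics.QuantumFieldTheory.Balaban1983to89.B9Eq315QFlatRightInverse
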